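import Literature.AlgebraicGeometry.Resolution.MacaulayficationKawasakiInduction
import HarnessLib

/-!
# Kawasaki's interwoven induction, Steps 1, 2 and 4 (Kawasaki 2000, proof of Thm. 3.1)

Topic: `Literature/AlgebraicGeometry/Resolution`. Brick of the proof of the named facts
`KawasakiMacaulayfication` / `CesnaviciusMacaulayfication`; sequel of
`MacaulayficationKawasakiInduction.lean` (the statements `Kawasaki.A31 … E31`). Following the
printed proof of Kawasaki 2000, Thm. 3.1 (pp. 2523–2524) verbatim:

* **Step 1** (`IsPStandard.kawasakiA31_self`): `(A_ii)` is Lemma 2.2 (Goto–Yamagishi) for the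
  `d`-sequence `xᵢ,…,x_d` on `M/(y₁,…,y_u)M` (Cor. 2.10);
* **Step 2** (`Kawasaki.b31_of_a31`): `(A_ij) ⇒ (B_ij)`, by induction on `l`;
* **Step 4** (`Kawasaki.d31_self`): `(D_ii)` is trivial (its right-hand side is
  `(y₁,…,y_{u-1},xᵢ)M`).

Everything is proved; no named fact is introduced.

## References

* [Kawasaki2000] T. Kawasaki, *On Macaulayfication of Noetherian schemes*, Trans. AMS 352 (2000)
  2517–2552, proof of Thm. 3.1, Steps 1, 2, 4.
-/

namespace Literature.AlgebraicGeometry.Resolution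

open Ideal Submodule Module IsLocalRing
open scoped Pointwise

universe u v

variable {R : Type u} [CommRing R] [IsLocalRing R]
variable {M : Type v} [AddCommGroup M] [Module R M]

/-! ## Step 1: `(A_ii)` -/

section StepOne

variable [IsNoetherianRing R] [Module.Finite R M]

/-- **Step 1 of Kawasaki 2000, Thm. 3.1: `(A_ii)` holds.** "Corollary 2.10 says that
`xᵢ,…,x_d` is a `d`-sequence on `M/(y₁,…,y_u)M`. Therefore `(A_ii)` coincides with Lemma 2.2."
[cite: Kawasaki2000, Thm. 3.1, Step 1] -/
theorem IsPStandard.kawasakiA31_self {xs : List R} (hx : IsPStandard M xs) (i : ℕ) :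
    Kawasaki.A31 M xs i i := by
  intro n hn ys hys hym k l hik hki hkl hl
  obtain rfl : k = i := le_antisymm hki hik
  obtain ⟨e, he⟩ : ∃ e, n k = e + 1 := ⟨n k - 1, by have := hn k (by simp); omega⟩
  have hK : IsKDSequence (ofList ys • ⊤ : Submodule R M) (xs.drop k) :=
    hx.isKDSequence (X₀ := xs.take k) (D := xs.drop k) (List.take_append_drop k xs).symm hys hym
  rw [prodPow_self, prodPow_self, Function.update_self, he, Nat.add_sub_cancel,
    ofList_append_smul]
  rcases hl.lt_or_eq with hl | rfl
  · -- `l ≤ d` in Kawasaki's numbering: the colon form of Lemma 2.2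
    have ht : l - k < (xs.drop k).length := by rw [List.length_drop]; omega
    have hx' : (xs.drop k)[l - k] = xs.getD l 1 := by
      rw [getD_eq_getElem hl]
      simp only [List.getElem_drop, Nat.add_sub_cancel' hkl]
    rw [← hx']
    exact hK.colonBy_inf_sup_pow_smul_top e ht
  · -- `l = d + 1` in Kawasaki's numbering (`x_{d+1} = 1`): the plain form of Lemma 2.2
    rw [getD_length, colonBy_one, seg_length]
    have := hK.sup_inf_sup_pow_smul_top e (xs.drop k).length
    rwa [List.take_length] at this

end StepOne

/-! ## Step 4: `(D_ii)` -/

/-- **Step 4 of Kawasaki 2000, Thm. 3.1: `(D_ii)` is trivial** — its right-hand side is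
`xᵢ·{[(Y)M + M] : y_u} + (Y)M = (Y, xᵢ)M`. [cite: Kawasaki2000, Thm. 3.1, Step 4] -/
theorem Kawasaki.d31_self (xs : List R) (i : ℕ) : Kawasaki.D31 M xs i i := by
  intro hi Y yu _ _
  rw [prodPow_of_lt (Nat.lt_succ_self i), Submodule.top_smul, sup_top_eq, colonBy_top]
  exact inf_le_right.trans le_sup_left

/-! ## Step 2: `(A_ij) ⇒ (B_ij)` -/

namespace Kawasaki

/-- **The inductive core of Step 2** (Kawasaki 2000, Thm. 3.1, Step 2, for one value of `l`):
given `(A_ij)` and the statement `(B_ij)` for the segment `x_{k},…,x_{l-1}` (as an inclusion;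
vacuous for the empty segment), the statement `(B_ij)` for `x_k,…,x_l` follows. With `a` in the
left-hand side write `y_ua = x_lb + c`, `b ∈ q^nM`; by `(A_ij)`, `b ∈ (y)M + (x_k,…,x_{l-1})q^{n'}M`
(`n'` = `n` with `n_k - 1`), so `b = y_ua' + c'`; then `a' ∈ [(Y)M + q^nM] : y_u` and
`a - x_la' ∈ [(Y)M + (x_k,…,x_{l-1})q^nM] : y_u`. [cite: Kawasaki2000, Thm. 3.1, Step 2] -/
theorem b31_core {xs : List R} {i j : ℕ} (hA : A31 M xs i j) {n : ℕ → ℕ} (hn : PosOn n i j)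
    {Y : List R} {yu : R} (hys : IsSecantSequence M (xs.drop i ++ (Y ++ [yu])))
    (hym : ∀ y ∈ Y ++ [yu], y ∈ maximalIdeal R) {k l : ℕ} (hik : i ≤ k) (hkj : k ≤ j)
    (hkl : k ≤ l) (hl : l < xs.length)
    (prev : colonBy (ofList Y • ⊤ ⊔ ofList (seg xs k l) • (prodPow xs n i j • ⊤) : Submodule R M) yu ≤
      ofList (seg xs k l) • colonBy (ofList Y • ⊤ ⊔ prodPow xs n i j • ⊤ : Submodule R M) yu ⊔
        colonBy (ofList Y • ⊤ : Submodule R M) yu) :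
    colonBy (ofList Y • ⊤ ⊔ ofList (seg xs k (l + 1)) • (prodPow xs n i j • ⊤) : Submodule R M) yu =
      ofList (seg xs k (l + 1)) • colonBy (ofList Y • ⊤ ⊔ prodPow xs n i j • ⊤ : Submodule R M) yu ⊔
        colonBy (ofList Y • ⊤ : Submodule R M) yu := by
  have hkIcc : k ∈ Finset.Icc i j := Finset.mem_Icc.mpr ⟨hik, hkj⟩
  have hnk : 0 < n k := hn k hkIcc
  have hxl : xs[l] ∈ tailIdeal xs k := getElem_mem_tailIdeal hkl hl
  rw [seg_succ hkl hl]
  refine le_antisymm ?_ (sup_le ?_ (colonBy_mono le_sup_left _))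
  swap
  · -- "The opposite inclusion is obvious"
    exact ideal_smul_colonBy_sup_le _ _ _ _
  intro a ha
  rw [mem_colonBy, ofList_append_smul, ofList_singleton, ← sup_assoc] at ha
  -- `y_u a = c + x_l b` with `b ∈ q^n M`
  obtain ⟨c, hc, bx, hbx, e1⟩ := Submodule.mem_sup.mp ha
  obtain ⟨b, hb, rfl⟩ := mem_span_singleton_smul_iff.mp hbx
  -- `b ∈ (y, x_k,…,x_{l-1})M : x_l ∩ [(y)M + q^nM]`, `y = Y, y_u`
  have hyua : yu • a ∈ (ofList ((Y ++ [yu]) ++ seg xs k l) • ⊤ : Submodule R M) := by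
    rw [ofList_append_smul]
    exact Submodule.mem_sup_left (smul_mem_ofList_smul_top (by simp) a)
  have hc' : c ∈ (ofList ((Y ++ [yu]) ++ seg xs k l) • ⊤ : Submodule R M) := by
    rw [ofList_append_smul, ofList_append_smul]
    have hle : (ofList Y • ⊤ ⊔ ofList (seg xs k l) • (prodPow xs n i j • ⊤) : Submodule R M) ≤
        (ofList Y • ⊤ ⊔ ofList [yu] • ⊤) ⊔ ofList (seg xs k l) • ⊤ :=
      sup_le_sup le_sup_left (Submodule.smul_mono le_rfl le_top)
    exact hle hc
  have hbA : b ∈ colonBy (ofList ((Y ++ [yu]) ++ seg xs k l) • ⊤ : Submodule R M) (xs.getD l 1) ⊓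
      (ofList (Y ++ [yu]) • ⊤ ⊔ prodPow xs n i j • ⊤) := by
    refine Submodule.mem_inf.mpr ⟨?_, Submodule.mem_sup_right hb⟩
    rw [mem_colonBy, getD_eq_getElem hl]
    have e : xs[l] • b = yu • a - c := by rw [← e1, add_sub_cancel_left]
    rw [e]
    exact Submodule.sub_mem _ hyua hc'
  rw [hA n hn (Y ++ [yu]) hys hym k l hik hkj hkl hl.le, ofList_append_smul, ofList_singleton,
    sup_right_comm] at hbA
  -- `b = c' + y_u a'` with `c' ∈ (Y)M + (x_k,…,x_{l-1})q^{n'}M`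
  obtain ⟨c', hc', t, ht, e2⟩ := Submodule.mem_sup.mp hbA
  obtain ⟨a', -, rfl⟩ := mem_span_singleton_smul_iff.mp ht
  -- re-absorption of the decremented exponent
  have hF1 : ofList (seg xs k l) • (prodPow xs (Function.update n k (n k - 1)) i j •
      (⊤ : Submodule R M)) ≤ prodPow xs n i j • ⊤ :=
    smul_prodPow_update_smul_le (ofList_seg_le_tailIdeal xs k l) hkIcc hnk ⊤
  have hF2 : span {xs[l]} • (prodPow xs (Function.update n k (n k - 1)) i j •
      (⊤ : Submodule R M)) ≤ prodPow xs n i j • ⊤ :=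
    smul_prodPow_update_smul_le ((Ideal.span_singleton_le_iff_mem _).mpr hxl) hkIcc hnk ⊤
  -- `a' ∈ [(Y)M + q^nM] : y_u`
  have ha' : a' ∈ colonBy (ofList Y • ⊤ ⊔ prodPow xs n i j • ⊤ : Submodule R M) yu := by
    rw [mem_colonBy]
    have e : yu • a' = b - c' := by rw [← e2, add_sub_cancel_left]
    rw [e]
    have hle : (ofList Y • ⊤ ⊔ ofList (seg xs k l) •
        (prodPow xs (Function.update n k (n k - 1)) i j • ⊤) : Submodule R M) ≤
          ofList Y • ⊤ ⊔ prodPow xs n i j • ⊤ :=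
      sup_le_sup_left hF1 _
    exact Submodule.sub_mem _ (Submodule.mem_sup_right hb) (hle hc')
  -- `a - x_l a' ∈ [(Y)M + (x_k,…,x_{l-1})q^nM] : y_u`
  have hrest : a - xs[l] • a' ∈
      colonBy (ofList Y • ⊤ ⊔ ofList (seg xs k l) • (prodPow xs n i j • ⊤) : Submodule R M) yu := by
    rw [mem_colonBy]
    have e : yu • (a - xs[l] • a') = c + xs[l] • c' := by
      have h1 : yu • a = c + xs[l] • b := e1.symm
      have h2 : xs[l] • b = xs[l] • c' + xs[l] • (yu • a') := by rw [← e2, smul_add]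
      rw [smul_sub, smul_comm yu xs[l] a', h1, h2]
      abel
    rw [e]
    refine Submodule.add_mem _ hc ?_
    -- `x_l c' ∈ x_l (Y)M + (x_k,…,x_{l-1}) x_l q^{n'} M ⊆ (Y)M + (x_k,…,x_{l-1}) q^n M`
    have hxc : xs[l] • c' ∈ span {xs[l]} • (ofList Y • ⊤ ⊔ ofList (seg xs k l) •
        (prodPow xs (Function.update n k (n k - 1)) i j • (⊤ : Submodule R M))) :=
      mem_span_singleton_smul_iff.mpr ⟨c', hc', rfl⟩
    have hle : span {xs[l]} • (ofList Y • ⊤ ⊔ ofList (seg xs k l) •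
        (prodPow xs (Function.update n k (n k - 1)) i j • (⊤ : Submodule R M))) ≤
          ofList Y • ⊤ ⊔ ofList (seg xs k l) • (prodPow xs n i j • ⊤) := by
      rw [Submodule.smul_sup]
      refine sup_le_sup Submodule.smul_le_right ?_
      rw [← Submodule.mul_smul, mul_comm, Submodule.mul_smul]
      exact Submodule.smul_mono le_rfl hF2
    exact hle hxc
  -- conclude with the statement for the shorter segment
  have e : a = xs[l] • a' + (a - xs[l] • a') := by abel
  rw [e, ofList_append_smul, ofList_singleton]
  refine Submodule.add_mem _ (Submodule.mem_sup_left (Submodule.mem_sup_right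
    (Submodule.smul_mem_smul (Ideal.mem_span_singleton_self _) ha'))) ?_
  have hle : ofList (seg xs k l) • colonBy (ofList Y • ⊤ ⊔ prodPow xs n i j • ⊤ : Submodule R M) yu ⊔
      colonBy (ofList Y • ⊤ : Submodule R M) yu ≤
        ofList (seg xs k l) • colonBy (ofList Y • ⊤ ⊔ prodPow xs n i j • ⊤ : Submodule R M) yu ⊔
          span {xs[l]} • colonBy (ofList Y • ⊤ ⊔ prodPow xs n i j • ⊤ : Submodule R M) yu ⊔
            colonBy (ofList Y • ⊤ : Submodule R M) yu :=
    sup_le_sup_right le_sup_left _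
  exact hle (prev hrest)

/-- **Step 2 of Kawasaki 2000, Thm. 3.1: `(A_ij) ⇒ (B_ij)`** ("By induction on `l`, we find
that `a` is in the right hand side of (3.1.2). The opposite inclusion is obvious.").
[cite: Kawasaki2000, Thm. 3.1, Step 2] -/
theorem b31_of_a31 {xs : List R} {i j : ℕ} (hA : A31 M xs i j) : B31 M xs i j := by
  intro n hn Y yu hys hym k l hik hkj hkl hl
  induction l, hkl using Nat.le_induction with
  | base =>
    refine b31_core hA hn hys hym hik hkj le_rfl hl ?_
    rw [seg_self, ofList_nil, Submodule.bot_smul, Submodule.bot_smul, sup_bot_eq, bot_sup_eq]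
  | succ l hkl ih =>
    exact b31_core hA hn hys hym hik hkj (Nat.le_succ_of_le hkl) hl (ih (Nat.lt_of_succ_lt hl)).le

end Kawasaki

end Literature.AlgebraicGeometry.Resolution
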